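import Summits.QuantumAdvantage.AdviceFreeQNC0.LowDegreeResidueAvoidanceF
import Mathlib.Analysis.SpecificLimits.Normed
import HarnessLib

/-!
# Cell qa-qnc0 (odd primes, rung F-Q2): `ElimHardF p` — `𝔽_p`-low-degree LEVEL SETS cannot
# eliminate `|u| mod 3` (every prime `p ≠ 3`)

From `lowDegAvoidMod3SparseF` (`LowDegreeResidueAvoidanceF.lean`, Srinivasan's robust Hegedűs
lemma with scale `q = p^j`), exactly as RingFrame's `ElimSqrtOfSparse`/`ElimHardOfSqrt`
(`EliminationHardness.lean`) but for the LEVEL-SET form the odd-prime rungs need (planner qa-qnc0-p2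
ROUND-13 §4/§6: the fibre input of R2 `WalkHardFAnchored`, R3 `WalkHardFGap`, R4 `WalkHardFSparse`):

* **`elimLevelSqrtF p`** — there are `η₀, c₀ > 0`, `n₀` such that for `n ≥ n₀`, `d ≤ c₀√n` and
  every `e : {0,1}ⁿ → ℕ` whose three level sets `{u : e u ≡ r (mod 3)}` have indicators in
  `lowDeg (ZMod p) n d`, the named residue is the TRUE one (`e u ≡ |u| (mod 3)`) on `≥ η₀·2ⁿ` inputs
  (the three level sets partition the cube; if each met its own class in `< η·2ⁿ` points each would be
  `1/4`-sparse, total `< 2ⁿ` — contradiction);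
* **`ElimHardF p`** (statement) and **`elimHardF : p ≠ 3 → ElimHardF p`** — the polylog-degree form
  (`(log₂ n)^C ≤ c₀√n` eventually).
The two-polynomials-with-decoder form of `ElimHard` follows (level sets of `dec(a u, b u)` are unions
of the `p²` level sets of `(a, b)`, indicators `(1 − (a−α)^{p−1})(1 − (b−β)^{p−1})`); not restated.

WHAT THIS IS NOT: nothing on the u-walk game itself (`WalkHardF p`, `p ≥ 5`, OPEN); no separation claim.
-/

noncomputable section

namespace Summit.QuantumAdvantage.AdviceFreeQNC0

open Finset
open Literature.Computability.MetaComplexity Literature.Computability.MetaComplexity.Smolensky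
open Literature.Computability.MetaComplexity.Hegedus

variable {n : ℕ}

/-! ### Level-set elimination is hard -/

/-- **`ElimLevelSqrtF`-shape, PROVED**: for a prime `p ≠ 3` there are `η₀, c₀ > 0`, `n₀` with: for
`n ≥ n₀`, `d ≤ c₀√n`, and every `e : {0,1}ⁿ → ℕ` whose three level sets mod `3` have indicators of
`𝔽_p`-degree `≤ d`, the named residue is the TRUE one, `e u ≡ |u| (mod 3)`, on `≥ η₀·2ⁿ` inputs. -/
theorem elimLevelSqrtF (p : ℕ) [Fact p.Prime] (hp3 : p ≠ 3) :
    ∃ η₀ : ℝ, 0 < η₀ ∧ ∃ c₀ : ℝ, 0 < c₀ ∧ ∃ n₀ : ℕ, ∀ n ≥ n₀, ∀ d : ℕ, (d : ℝ) ≤ c₀ * Real.sqrt n →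
      ∀ e : (Fin n → Bool) → ℕ,
        (∀ r : ℕ, (fun u => if e u % 3 = r % 3 then (1 : ZMod p) else 0) ∈
          Smolensky.lowDeg (ZMod p) n d) →
        η₀ * (2 : ℝ) ^ n ≤ ((Finset.univ.filter fun u : Fin n → Bool =>
          e u % 3 = Hegedus.wt u % 3).card : ℝ) := by
  classical
  obtain ⟨η, hη, c₁, hc₁, n₀, H⟩ := lowDegAvoidMod3SparseF p hp3 (1 / 4) (by norm_num)
  refine ⟨η, hη, c₁, hc₁, n₀, fun n hn d hd e he => ?_⟩
  by_contra hlt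
  rw [not_le] at hlt
  -- every level set is `1/4`-sparse
  have key : ∀ r : ℕ, ((univ.filter fun u : Fin n → Bool => e u % 3 = r % 3).card : ℝ) ≤
      1 / 4 * (2 : ℝ) ^ n := by
    intro r
    set g : CubeFn (ZMod p) n := fun u => if e u % 3 = r % 3 then (1 : ZMod p) else 0 with hg
    have hsupp : (univ.filter fun u : Fin n → Bool => g u ≠ 0) =
        univ.filter fun u : Fin n → Bool => e u % 3 = r % 3 := by
      refine filter_congr fun u _ => ?_
      simp only [hg]
      split_ifs with h
      · simp [h]
      · simp [h]
    have hclass : ((univ.filter fun u : Fin n → Bool => g u ≠ 0 ∧ wt u % 3 = r % 3).card : ℝ) ≤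
        η * (2 : ℝ) ^ n := by
      have hsub : (univ.filter fun u : Fin n → Bool => g u ≠ 0 ∧ wt u % 3 = r % 3) ⊆
          univ.filter fun u : Fin n → Bool => e u % 3 = wt u % 3 := by
        intro u hu
        rw [mem_filter] at hu ⊢
        have h1 : e u % 3 = r % 3 := by
          by_contra h
          exact hu.2.1 (by simp [hg, h])
        exact ⟨hu.1, h1.trans hu.2.2.symm⟩
      have := card_le_card hsub
      have : ((univ.filter fun u : Fin n → Bool => g u ≠ 0 ∧ wt u % 3 = r % 3).card : ℝ) ≤
          ((univ.filter fun u : Fin n → Bool => e u % 3 = wt u % 3).card : ℝ) := by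
        exact_mod_cast this
      linarith
    have hres := H n hn r d hd g (he r) hclass
    rwa [hsupp] at hres
  -- but the three level sets cover the cube
  have hcover : ∑ r ∈ range 3, (univ.filter fun u : Fin n → Bool => e u % 3 = r % 3).card =
      2 ^ n := by
    have h := card_eq_sum_card_fiberwise (s := (univ : Finset (Fin n → Bool)))
      (t := range 3) (f := fun u => e u % 3) (fun u _ => mem_range.2 (Nat.mod_lt _ (by norm_num)))
    have hU : (univ : Finset (Fin n → Bool)).card = 2 ^ n := by simp
    rw [← hU, h]
    refine sum_congr rfl fun r hr => ?_
    rw [mem_range] at hr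
    congr 1
    ext u
    simp only [mem_filter, mem_univ, true_and]
    rw [Nat.mod_eq_of_lt hr]
  have hcoverR : ∑ r ∈ range 3,
      ((univ.filter fun u : Fin n → Bool => e u % 3 = r % 3).card : ℝ) = (2 : ℝ) ^ n := by
    exact_mod_cast hcover
  have hle : ∑ r ∈ range 3,
      ((univ.filter fun u : Fin n → Bool => e u % 3 = r % 3).card : ℝ) ≤
        ∑ _r ∈ range 3, 1 / 4 * (2 : ℝ) ^ n := sum_le_sum fun r _ => key r
  rw [sum_const, card_range, hcoverR] at hle
  have hpos : (0 : ℝ) < (2 : ℝ) ^ n := by positivity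
  norm_num at hle
  linarith

/-- `(log₂ n)^C ≤ c₀ √n` for `n ≥ n₀(C, c₀)`. -/
private theorem logPow_le_sqrtF (C : ℕ) {c₀ : ℝ} (hc₀ : 0 < c₀) :
    ∃ n₀ : ℕ, ∀ n : ℕ, n₀ ≤ n → ((Nat.log 2 n ^ C : ℕ) : ℝ) ≤ c₀ * Real.sqrt n := by
  have hr : (1 : ℝ) < Real.sqrt 2 := by
    rw [show (1 : ℝ) = Real.sqrt 1 by simp]
    exact Real.sqrt_lt_sqrt (by norm_num) (by norm_num)
  have ht := tendsto_pow_const_div_const_pow_of_one_lt C hr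
  obtain ⟨K₀, hK₀⟩ := Filter.eventually_atTop.1 (ht.eventually_le_const hc₀)
  refine ⟨2 ^ K₀, fun n hn => ?_⟩
  have hn0 : n ≠ 0 := by
    have : 0 < 2 ^ K₀ := Nat.pos_of_ne_zero (by positivity)
    omega
  set k := Nat.log 2 n with hk_def
  have hk : K₀ ≤ k := Nat.le_log_of_pow_le one_lt_two hn
  have h2k : (2 : ℝ) ^ k ≤ n := by exact_mod_cast Nat.pow_log_le_self 2 hn0
  have hs_pos : 0 < Real.sqrt 2 ^ k := pow_pos (by positivity) k
  have hsq2 : (Real.sqrt 2 ^ k) ^ 2 = (2 : ℝ) ^ k := by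
    rw [← pow_mul, mul_comm, pow_mul, Real.sq_sqrt (by norm_num : (0 : ℝ) ≤ 2)]
  have hle : Real.sqrt 2 ^ k ≤ Real.sqrt n := Real.le_sqrt_of_sq_le (by rw [hsq2]; exact h2k)
  have hK := hK₀ k hk
  rw [div_le_iff₀ hs_pos] at hK
  push_cast
  calc (k : ℝ) ^ C ≤ c₀ * Real.sqrt 2 ^ k := hK
    _ ≤ c₀ * Real.sqrt n := by gcongr

/-- **`ElimHardF p`** — level-set elimination of `|u| mod 3` is impossible at polylog `𝔽_p`-degree:
there is `η₀ > 0` (depending on `p`) such that for every `C`, for all large `n`, every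
`e : {0,1}ⁿ → ℕ` whose three residue-level sets have indicators of `𝔽_p`-degree `≤ (log₂ n)^C`
satisfies `e u ≡ |u| (mod 3)` on at least `η₀·2ⁿ` inputs.  (The `𝔽_p` form of RingFrame's
`ElimHard`; planner qa-qnc0-p2 ROUND-12 §B.6(b), ROUND-13 §6.) -/
def ElimHardF (p : ℕ) [Fact p.Prime] : Prop :=
  ∃ η₀ : ℝ, 0 < η₀ ∧ ∀ C : ℕ, ∃ n₀ : ℕ, ∀ n ≥ n₀, ∀ e : (Fin n → Bool) → ℕ,
    (∀ r : ℕ, (fun u => if e u % 3 = r % 3 then (1 : ZMod p) else 0) ∈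
      Smolensky.lowDeg (ZMod p) n ((Nat.log 2 n) ^ C)) →
    η₀ * (2 : ℝ) ^ n ≤ ((Finset.univ.filter fun u : Fin n → Bool =>
      e u % 3 = Hegedus.wt u % 3).card : ℝ)

/-- **`ElimHardF p` — PROVED for every prime `p ≠ 3`.** -/
theorem elimHardF (p : ℕ) [Fact p.Prime] (hp3 : p ≠ 3) : ElimHardF p := by
  obtain ⟨η₀, hη₀, c₀, hc₀, n₀, H⟩ := elimLevelSqrtF p hp3
  refine ⟨η₀, hη₀, fun C => ?_⟩
  obtain ⟨n₁, hn₁⟩ := logPow_le_sqrtF C hc₀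
  refine ⟨max n₀ n₁, fun n hn e he => ?_⟩
  exact H n (le_trans (le_max_left _ _) hn) (Nat.log 2 n ^ C)
    (hn₁ n (le_trans (le_max_right _ _) hn)) e he


/-! ### Error-robust level-set elimination (the input for probabilistic-degree rungs) -/

/-- **`elimLevelSqrtF_robust`** — level-set elimination of `|u| mod 3` stays impossible when the three
level-set indicators are only APPROXIMATELY of low `𝔽_p`-degree: for a prime `p ≠ 3` there are
`η₀, ε₀, c₀ > 0`, `n₀` such that for `n ≥ n₀`, `d ≤ c₀√n`, every `e : {0,1}ⁿ → ℕ` and every exceptional set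
`X` with `|X| ≤ ε₀·2ⁿ`, if for each residue `r` some `P_r ∈ lowDeg (ZMod p) n d` agrees with the indicator of
`{u : e u ≡ r (mod 3)}` outside `X`, then `e u ≡ |u| (mod 3)` on `≥ η₀·2ⁿ` inputs.  (From
`lowDegAvoidMod3SparseF` with `γ = 1/4`: if the hits were `< (η/2)·2ⁿ`, each `supp P_r` would meet the class
`r` in `< η·2ⁿ` points, hence be `1/4`-sparse, and the three level sets — each inside `supp P_r ∪ X` — would
cover `< (3/4 + 3ε₀)·2ⁿ < 2ⁿ` points.)  This is the elimination input for rungs that use PROBABILISTIC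
polynomials (seat qn-p2's `R6`, √n shots), where the level sets are low-degree only off a small error set. -/
theorem elimLevelSqrtF_robust (p : ℕ) [Fact p.Prime] (hp3 : p ≠ 3) :
    ∃ η₀ : ℝ, 0 < η₀ ∧ ∃ ε₀ : ℝ, 0 < ε₀ ∧ ∃ c₀ : ℝ, 0 < c₀ ∧ ∃ n₀ : ℕ, ∀ n ≥ n₀, ∀ d : ℕ,
      (d : ℝ) ≤ c₀ * Real.sqrt n → ∀ e : (Fin n → Bool) → ℕ, ∀ X : Finset (Fin n → Bool),
        (X.card : ℝ) ≤ ε₀ * (2 : ℝ) ^ n →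
        (∀ r : ℕ, ∃ P : Smolensky.CubeFn (ZMod p) n, P ∈ Smolensky.lowDeg (ZMod p) n d ∧
          ∀ u, u ∉ X → P u = if e u % 3 = r % 3 then (1 : ZMod p) else 0) →
        η₀ * (2 : ℝ) ^ n ≤ ((Finset.univ.filter fun u : Fin n → Bool =>
          e u % 3 = Hegedus.wt u % 3).card : ℝ) := by
  classical
  obtain ⟨η, hη, c₁, hc₁, n₀, H⟩ := lowDegAvoidMod3SparseF p hp3 (1 / 4) (by norm_num)
  refine ⟨η / 2, by linarith, min (η / 2) (1 / 13), lt_min (by linarith) (by norm_num), c₁, hc₁, n₀,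
    fun n hn d hd e X hX hP => ?_⟩
  have hε₁ : min (η / 2) (1 / 13) ≤ η / 2 := min_le_left _ _
  have hε₂ : min (η / 2) (1 / 13) ≤ 1 / 13 := min_le_right _ _
  have h2n : (0 : ℝ) < (2 : ℝ) ^ n := by positivity
  by_contra hlt
  rw [not_le] at hlt
  -- every level set has at most `(1/4 + ε₀)·2ⁿ` points
  have key : ∀ r : ℕ, ((univ.filter fun u : Fin n → Bool => e u % 3 = r % 3).card : ℝ) ≤
      1 / 4 * (2 : ℝ) ^ n + (X.card : ℝ) := by
    intro r
    obtain ⟨P, hPd, hPX⟩ := hP r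
    -- the support of `P` meets the class `r` only at hits or inside `X`
    have hclass : ((univ.filter fun u : Fin n → Bool => P u ≠ 0 ∧ wt u % 3 = r % 3).card : ℝ) ≤
        η * (2 : ℝ) ^ n := by
      have hsub : (univ.filter fun u : Fin n → Bool => P u ≠ 0 ∧ wt u % 3 = r % 3) ⊆
          (univ.filter fun u : Fin n → Bool => e u % 3 = wt u % 3) ∪ X := by
        intro u hu
        rw [mem_filter] at hu
        rw [mem_union, mem_filter]
        by_cases hx : u ∈ X
        · exact Or.inr hx
        · left
          have h1 : e u % 3 = r % 3 := by
            by_contra h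
            exact hu.2.1 (by rw [hPX u hx, if_neg h])
          exact ⟨mem_univ _, h1.trans hu.2.2.symm⟩
      have h1 := (card_le_card hsub).trans (card_union_le _ _)
      have h2 : ((univ.filter fun u : Fin n → Bool => P u ≠ 0 ∧ wt u % 3 = r % 3).card : ℝ) ≤
          ((univ.filter fun u : Fin n → Bool => e u % 3 = wt u % 3).card : ℝ) + X.card := by
        exact_mod_cast h1
      have h3 : (X.card : ℝ) ≤ η / 2 * (2 : ℝ) ^ n := hX.trans (mul_le_mul_of_nonneg_right hε₁ h2n.le)
      linarith
    have hsupp := H n hn r d hd P hPd hclass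
    -- the level set lies inside `supp P ∪ X`
    have hsub : (univ.filter fun u : Fin n → Bool => e u % 3 = r % 3) ⊆
        (univ.filter fun u : Fin n → Bool => P u ≠ 0) ∪ X := by
      intro u hu
      rw [mem_filter] at hu
      rw [mem_union, mem_filter]
      by_cases hx : u ∈ X
      · exact Or.inr hx
      · left
        refine ⟨mem_univ _, ?_⟩
        rw [hPX u hx, if_pos hu.2]
        exact one_ne_zero
    have h1 := (card_le_card hsub).trans (card_union_le _ _)
    have h2 : ((univ.filter fun u : Fin n → Bool => e u % 3 = r % 3).card : ℝ) ≤
        ((univ.filter fun u : Fin n → Bool => P u ≠ 0).card : ℝ) + X.card := by exact_mod_cast h1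
    linarith
  -- but the three level sets cover the cube
  have hcover : ∑ r ∈ range 3, (univ.filter fun u : Fin n → Bool => e u % 3 = r % 3).card =
      2 ^ n := by
    have h := card_eq_sum_card_fiberwise (s := (univ : Finset (Fin n → Bool)))
      (t := range 3) (f := fun u => e u % 3) (fun u _ => mem_range.2 (Nat.mod_lt _ (by norm_num)))
    have hU : (univ : Finset (Fin n → Bool)).card = 2 ^ n := by simp
    rw [← hU, h]
    refine sum_congr rfl fun r hr => ?_
    rw [mem_range] at hr
    congr 1
    ext u
    simp only [mem_filter, mem_univ, true_and]
    rw [Nat.mod_eq_of_lt hr]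
  have hcoverR : ∑ r ∈ range 3,
      ((univ.filter fun u : Fin n → Bool => e u % 3 = r % 3).card : ℝ) = (2 : ℝ) ^ n := by
    exact_mod_cast hcover
  have hle : ∑ r ∈ range 3,
      ((univ.filter fun u : Fin n → Bool => e u % 3 = r % 3).card : ℝ) ≤
        ∑ _r ∈ range 3, (1 / 4 * (2 : ℝ) ^ n + (X.card : ℝ)) := sum_le_sum fun r _ => key r
  rw [sum_const, card_range, hcoverR] at hle
  have hX' : (X.card : ℝ) ≤ 1 / 13 * (2 : ℝ) ^ n := hX.trans (mul_le_mul_of_nonneg_right hε₂ h2n.le)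
  norm_num at hle
  linarith

end Summit.QuantumAdvantage.AdviceFreeQNC0
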